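import Mathlib.LinearAlgebra.Matrix.Determinant.Basic
import Mathlib.Data.Real.Basic
import Mathlib.Tactic

/-!
# The Levi-Civita rows on `Fin 4` as `0/1` determinants (for `DualityDefect.ContactIdentity`)

The route file `Summits/QuantumFields/YangMills/Theses/DualityDefect.lean` realises the
Levi-Civita symbol `ε_{ijkl}` as `Matrix.det (Matrix.of fun a b => δ (![i, j, k, l] a) b)` with
`δ` the Kronecker delta. For each numeral pair `(m, n)` we evaluate, definition-free,
`Σ_{a b} ε_{mnab} · f a b = f k l - f l k` where `(m, n, k, l)` is the even completion
(and `= 0` when `m = n`): sixteen `4 × 4` determinants of `0/1` matrices per lemma, by cofactor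
expansion. These rows are what the contact identity `stmt-QuantumFields-11700` is summed against.
-/

namespace Summit.QuantumFields.YangMills.Theorems

open Matrix

/-- Row `(0, 0)` of the Levi-Civita symbol on `Fin 4`, realised as `0/1` determinants:
`Σ_{a b} ε_{00ab} · f a b = 0` (a repeated index). -/
theorem dualityDefect_sumEps_00 (f : Fin 4 → Fin 4 → ℝ) :
    ∑ a : Fin 4, ∑ b : Fin 4, Matrix.det (Matrix.of fun a' b' : Fin 4 =>
        if (![(0 : Fin 4), 0, a, b] a') = b' then (1 : ℝ) else 0) * f a b = 0 := by
  simp only [Fin.sum_univ_four]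
  simp [Matrix.det_succ_row_zero, Fin.sum_univ_succ, Matrix.of_apply, Fin.succAbove,
    Matrix.submatrix]

/-- Row `(0, 1)` of the Levi-Civita symbol on `Fin 4`, realised as `0/1` determinants:
`Σ_{a b} ε_{01ab} · f a b = f 2 3 - f 3 2` (`(0, 1, 2, 3)` is even). -/
theorem dualityDefect_sumEps_01 (f : Fin 4 → Fin 4 → ℝ) :
    ∑ a : Fin 4, ∑ b : Fin 4, Matrix.det (Matrix.of fun a' b' : Fin 4 =>
        if (![(0 : Fin 4), 1, a, b] a') = b' then (1 : ℝ) else 0) * f a b = f 2 3 - f 3 2 := by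
  simp only [Fin.sum_univ_four]
  simp [Matrix.det_succ_row_zero, Fin.sum_univ_succ, Matrix.of_apply, Fin.succAbove,
    Matrix.submatrix]
  ring

/-- Row `(0, 2)` of the Levi-Civita symbol on `Fin 4`, realised as `0/1` determinants:
`Σ_{a b} ε_{02ab} · f a b = f 3 1 - f 1 3` (`(0, 2, 3, 1)` is even). -/
theorem dualityDefect_sumEps_02 (f : Fin 4 → Fin 4 → ℝ) :
    ∑ a : Fin 4, ∑ b : Fin 4, Matrix.det (Matrix.of fun a' b' : Fin 4 =>
        if (![(0 : Fin 4), 2, a, b] a') = b' then (1 : ℝ) else 0) * f a b = f 3 1 - f 1 3 := by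
  simp only [Fin.sum_univ_four]
  simp [Matrix.det_succ_row_zero, Fin.sum_univ_succ, Matrix.of_apply, Fin.succAbove,
    Matrix.submatrix]
  ring

/-- Row `(0, 3)` of the Levi-Civita symbol on `Fin 4`, realised as `0/1` determinants:
`Σ_{a b} ε_{03ab} · f a b = f 1 2 - f 2 1` (`(0, 3, 1, 2)` is even). -/
theorem dualityDefect_sumEps_03 (f : Fin 4 → Fin 4 → ℝ) :
    ∑ a : Fin 4, ∑ b : Fin 4, Matrix.det (Matrix.of fun a' b' : Fin 4 =>
        if (![(0 : Fin 4), 3, a, b] a') = b' then (1 : ℝ) else 0) * f a b = f 1 2 - f 2 1 := by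
  simp only [Fin.sum_univ_four]
  simp [Matrix.det_succ_row_zero, Fin.sum_univ_succ, Matrix.of_apply, Fin.succAbove,
    Matrix.submatrix]
  ring

/-- Row `(1, 0)` of the Levi-Civita symbol on `Fin 4`, realised as `0/1` determinants:
`Σ_{a b} ε_{10ab} · f a b = f 3 2 - f 2 3` (`(1, 0, 3, 2)` is even). -/
theorem dualityDefect_sumEps_10 (f : Fin 4 → Fin 4 → ℝ) :
    ∑ a : Fin 4, ∑ b : Fin 4, Matrix.det (Matrix.of fun a' b' : Fin 4 =>
        if (![(1 : Fin 4), 0, a, b] a') = b' then (1 : ℝ) else 0) * f a b = f 3 2 - f 2 3 := by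
  simp only [Fin.sum_univ_four]
  simp [Matrix.det_succ_row_zero, Fin.sum_univ_succ, Matrix.of_apply, Fin.succAbove,
    Matrix.submatrix]
  ring

/-- Row `(1, 1)` of the Levi-Civita symbol on `Fin 4`, realised as `0/1` determinants:
`Σ_{a b} ε_{11ab} · f a b = 0` (a repeated index). -/
theorem dualityDefect_sumEps_11 (f : Fin 4 → Fin 4 → ℝ) :
    ∑ a : Fin 4, ∑ b : Fin 4, Matrix.det (Matrix.of fun a' b' : Fin 4 =>
        if (![(1 : Fin 4), 1, a, b] a') = b' then (1 : ℝ) else 0) * f a b = 0 := by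
  simp only [Fin.sum_univ_four]
  simp [Matrix.det_succ_row_zero, Fin.sum_univ_succ, Matrix.of_apply, Fin.succAbove,
    Matrix.submatrix]

/-- Row `(1, 2)` of the Levi-Civita symbol on `Fin 4`, realised as `0/1` determinants:
`Σ_{a b} ε_{12ab} · f a b = f 0 3 - f 3 0` (`(1, 2, 0, 3)` is even). -/
theorem dualityDefect_sumEps_12 (f : Fin 4 → Fin 4 → ℝ) :
    ∑ a : Fin 4, ∑ b : Fin 4, Matrix.det (Matrix.of fun a' b' : Fin 4 =>
        if (![(1 : Fin 4), 2, a, b] a') = b' then (1 : ℝ) else 0) * f a b = f 0 3 - f 3 0 := by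
  simp only [Fin.sum_univ_four]
  simp [Matrix.det_succ_row_zero, Fin.sum_univ_succ, Matrix.of_apply, Fin.succAbove,
    Matrix.submatrix]
  ring

/-- Row `(1, 3)` of the Levi-Civita symbol on `Fin 4`, realised as `0/1` determinants:
`Σ_{a b} ε_{13ab} · f a b = f 2 0 - f 0 2` (`(1, 3, 2, 0)` is even). -/
theorem dualityDefect_sumEps_13 (f : Fin 4 → Fin 4 → ℝ) :
    ∑ a : Fin 4, ∑ b : Fin 4, Matrix.det (Matrix.of fun a' b' : Fin 4 =>
        if (![(1 : Fin 4), 3, a, b] a') = b' then (1 : ℝ) else 0) * f a b = f 2 0 - f 0 2 := by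
  simp only [Fin.sum_univ_four]
  simp [Matrix.det_succ_row_zero, Fin.sum_univ_succ, Matrix.of_apply, Fin.succAbove,
    Matrix.submatrix]
  ring

/-- Row `(2, 0)` of the Levi-Civita symbol on `Fin 4`, realised as `0/1` determinants:
`Σ_{a b} ε_{20ab} · f a b = f 1 3 - f 3 1` (`(2, 0, 1, 3)` is even). -/
theorem dualityDefect_sumEps_20 (f : Fin 4 → Fin 4 → ℝ) :
    ∑ a : Fin 4, ∑ b : Fin 4, Matrix.det (Matrix.of fun a' b' : Fin 4 =>
        if (![(2 : Fin 4), 0, a, b] a') = b' then (1 : ℝ) else 0) * f a b = f 1 3 - f 3 1 := by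
  simp only [Fin.sum_univ_four]
  simp [Matrix.det_succ_row_zero, Fin.sum_univ_succ, Matrix.of_apply, Fin.succAbove,
    Matrix.submatrix]
  ring

/-- Row `(2, 1)` of the Levi-Civita symbol on `Fin 4`, realised as `0/1` determinants:
`Σ_{a b} ε_{21ab} · f a b = f 3 0 - f 0 3` (`(2, 1, 3, 0)` is even). -/
theorem dualityDefect_sumEps_21 (f : Fin 4 → Fin 4 → ℝ) :
    ∑ a : Fin 4, ∑ b : Fin 4, Matrix.det (Matrix.of fun a' b' : Fin 4 =>
        if (![(2 : Fin 4), 1, a, b] a') = b' then (1 : ℝ) else 0) * f a b = f 3 0 - f 0 3 := by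
  simp only [Fin.sum_univ_four]
  simp [Matrix.det_succ_row_zero, Fin.sum_univ_succ, Matrix.of_apply, Fin.succAbove,
    Matrix.submatrix]
  ring

/-- Row `(2, 2)` of the Levi-Civita symbol on `Fin 4`, realised as `0/1` determinants:
`Σ_{a b} ε_{22ab} · f a b = 0` (a repeated index). -/
theorem dualityDefect_sumEps_22 (f : Fin 4 → Fin 4 → ℝ) :
    ∑ a : Fin 4, ∑ b : Fin 4, Matrix.det (Matrix.of fun a' b' : Fin 4 =>
        if (![(2 : Fin 4), 2, a, b] a') = b' then (1 : ℝ) else 0) * f a b = 0 := by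
  simp only [Fin.sum_univ_four]
  simp [Matrix.det_succ_row_zero, Fin.sum_univ_succ, Matrix.of_apply, Fin.succAbove,
    Matrix.submatrix]

/-- Row `(2, 3)` of the Levi-Civita symbol on `Fin 4`, realised as `0/1` determinants:
`Σ_{a b} ε_{23ab} · f a b = f 0 1 - f 1 0` (`(2, 3, 0, 1)` is even). -/
theorem dualityDefect_sumEps_23 (f : Fin 4 → Fin 4 → ℝ) :
    ∑ a : Fin 4, ∑ b : Fin 4, Matrix.det (Matrix.of fun a' b' : Fin 4 =>
        if (![(2 : Fin 4), 3, a, b] a') = b' then (1 : ℝ) else 0) * f a b = f 0 1 - f 1 0 := by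
  simp only [Fin.sum_univ_four]
  simp [Matrix.det_succ_row_zero, Fin.sum_univ_succ, Matrix.of_apply, Fin.succAbove,
    Matrix.submatrix]
  ring

/-- Row `(3, 0)` of the Levi-Civita symbol on `Fin 4`, realised as `0/1` determinants:
`Σ_{a b} ε_{30ab} · f a b = f 2 1 - f 1 2` (`(3, 0, 2, 1)` is even). -/
theorem dualityDefect_sumEps_30 (f : Fin 4 → Fin 4 → ℝ) :
    ∑ a : Fin 4, ∑ b : Fin 4, Matrix.det (Matrix.of fun a' b' : Fin 4 =>
        if (![(3 : Fin 4), 0, a, b] a') = b' then (1 : ℝ) else 0) * f a b = f 2 1 - f 1 2 := by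
  simp only [Fin.sum_univ_four]
  simp [Matrix.det_succ_row_zero, Fin.sum_univ_succ, Matrix.of_apply, Fin.succAbove,
    Matrix.submatrix]
  ring

/-- Row `(3, 1)` of the Levi-Civita symbol on `Fin 4`, realised as `0/1` determinants:
`Σ_{a b} ε_{31ab} · f a b = f 0 2 - f 2 0` (`(3, 1, 0, 2)` is even). -/
theorem dualityDefect_sumEps_31 (f : Fin 4 → Fin 4 → ℝ) :
    ∑ a : Fin 4, ∑ b : Fin 4, Matrix.det (Matrix.of fun a' b' : Fin 4 =>
        if (![(3 : Fin 4), 1, a, b] a') = b' then (1 : ℝ) else 0) * f a b = f 0 2 - f 2 0 := by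
  simp only [Fin.sum_univ_four]
  simp [Matrix.det_succ_row_zero, Fin.sum_univ_succ, Matrix.of_apply, Fin.succAbove,
    Matrix.submatrix]
  ring

/-- Row `(3, 2)` of the Levi-Civita symbol on `Fin 4`, realised as `0/1` determinants:
`Σ_{a b} ε_{32ab} · f a b = f 1 0 - f 0 1` (`(3, 2, 1, 0)` is even). -/
theorem dualityDefect_sumEps_32 (f : Fin 4 → Fin 4 → ℝ) :
    ∑ a : Fin 4, ∑ b : Fin 4, Matrix.det (Matrix.of fun a' b' : Fin 4 =>
        if (![(3 : Fin 4), 2, a, b] a') = b' then (1 : ℝ) else 0) * f a b = f 1 0 - f 0 1 := by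
  simp only [Fin.sum_univ_four]
  simp [Matrix.det_succ_row_zero, Fin.sum_univ_succ, Matrix.of_apply, Fin.succAbove,
    Matrix.submatrix]
  ring

/-- Row `(3, 3)` of the Levi-Civita symbol on `Fin 4`, realised as `0/1` determinants:
`Σ_{a b} ε_{33ab} · f a b = 0` (a repeated index). -/
theorem dualityDefect_sumEps_33 (f : Fin 4 → Fin 4 → ℝ) :
    ∑ a : Fin 4, ∑ b : Fin 4, Matrix.det (Matrix.of fun a' b' : Fin 4 =>
        if (![(3 : Fin 4), 3, a, b] a') = b' then (1 : ℝ) else 0) * f a b = 0 := by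
  simp only [Fin.sum_univ_four]
  simp [Matrix.det_succ_row_zero, Fin.sum_univ_succ, Matrix.of_apply, Fin.succAbove,
    Matrix.submatrix]

end Summit.QuantumFields.YangMills.Theorems
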